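import Summits.NavierStokesRegularity.TurbBounds.LadderTail
import HarnessLib

/-!
# Row RB-N1b tail lemma (dim 42, two-sided PROJECTED) — integration-ladder linear forms on the kept vector and their dictionary
(cell `pub-turb` / `turb-bounds`; v2; GENERATED by pub-turb-cert gen 8 (prover-pub-turb-cert-g8-0) running the gen-7 tool `emit_rbP.py N1bG2n12` (merge of tailgen/emit/emit_tail.py and emit_rb.py). Full stacked sizes `LW = 23`, `LT = 22`; the row's rule lives on
the KEPT coordinates `x = (c_2..c_22; d_1..d_21)` (rbsdp SPEC 3.3 projection to the no-slip class `c_0 = c_1 = d_0 = 0`, i.e.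
`W(1) = W′(1) = Θ(1) = 0` at the far wall). `xc/xd` re-insert the zero coordinates; `aL, bL, eL` = Legendre coefficients of `W′, W, Θ` by
the ladders of SPEC 1.2; the dictionary theorems hold on ladder sequences WITH `c 0 = c 1 = 0`, `d 0 = 0`.)

HONEST FRAMING: rigorous bounds for the stated PDE and boundary conditions; no claim about physical turbulence beyond the bound.
-/

set_option linter.style.longLine false

noncomputable section

namespace Summit.NavierStokesRegularity.TurbBounds.TailN1bG2n12

open Finset Summit.NavierStokesRegularity.TurbBounds.LadderTail

/-- full `c`-sequence from the kept vector (`c_0 = c_1 = 0`, zero beyond `LW = 23`) -/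
def xc (x : Fin 42 → ℝ) : ℕ → ℝ
  | 0 => 0
  | 1 => 0
  | 2 => x 0
  | 3 => x 1
  | 4 => x 2
  | 5 => x 3
  | 6 => x 4
  | 7 => x 5
  | 8 => x 6
  | 9 => x 7
  | 10 => x 8
  | 11 => x 9
  | 12 => x 10
  | 13 => x 11
  | 14 => x 12
  | 15 => x 13
  | 16 => x 14
  | 17 => x 15
  | 18 => x 16
  | 19 => x 17
  | 20 => x 18
  | 21 => x 19
  | 22 => x 20
  | _ => 0

/-- full `d`-sequence from the kept vector (`d_0 = 0`, zero beyond `LT = 22`) -/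
def xd (x : Fin 42 → ℝ) : ℕ → ℝ
  | 0 => 0
  | 1 => x 21
  | 2 => x 22
  | 3 => x 23
  | 4 => x 24
  | 5 => x 25
  | 6 => x 26
  | 7 => x 27
  | 8 => x 28
  | 9 => x 29
  | 10 => x 30
  | 11 => x 31
  | 12 => x 32
  | 13 => x 33
  | 14 => x 34
  | 15 => x 35
  | 16 => x 36
  | 17 => x 37
  | 18 => x 38
  | 19 => x 39
  | 20 => x 40
  | 21 => x 41
  | _ => 0

/-- ladder forms `a_n`, `n ≤ 21` (coefficients of `W′`) -/
def aL (x : Fin 42 → ℝ) : ℕ → ℝ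
  | 0 => xc x 0 - xc x 1 / 3
  | 1 => xc x 0 / 1 - xc x 2 / 5
  | 2 => xc x 1 / 3 - xc x 3 / 7
  | 3 => xc x 2 / 5 - xc x 4 / 9
  | 4 => xc x 3 / 7 - xc x 5 / 11
  | 5 => xc x 4 / 9 - xc x 6 / 13
  | 6 => xc x 5 / 11 - xc x 7 / 15
  | 7 => xc x 6 / 13 - xc x 8 / 17
  | 8 => xc x 7 / 15 - xc x 9 / 19
  | 9 => xc x 8 / 17 - xc x 10 / 21
  | 10 => xc x 9 / 19 - xc x 11 / 23
  | 11 => xc x 10 / 21 - xc x 12 / 25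
  | 12 => xc x 11 / 23 - xc x 13 / 27
  | 13 => xc x 12 / 25 - xc x 14 / 29
  | 14 => xc x 13 / 27 - xc x 15 / 31
  | 15 => xc x 14 / 29 - xc x 16 / 33
  | 16 => xc x 15 / 31 - xc x 17 / 35
  | 17 => xc x 16 / 33 - xc x 18 / 37
  | 18 => xc x 17 / 35 - xc x 19 / 39
  | 19 => xc x 18 / 37 - xc x 20 / 41
  | 20 => xc x 19 / 39 - xc x 21 / 43
  | 21 => xc x 20 / 41 - xc x 22 / 45
  | _ => 0

/-- ladder forms `b_n`, `n ≤ 20` (coefficients of `W`) -/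
def bL (x : Fin 42 → ℝ) : ℕ → ℝ
  | 0 => aL x 0 - aL x 1 / 3
  | 1 => aL x 0 / 1 - aL x 2 / 5
  | 2 => aL x 1 / 3 - aL x 3 / 7
  | 3 => aL x 2 / 5 - aL x 4 / 9
  | 4 => aL x 3 / 7 - aL x 5 / 11
  | 5 => aL x 4 / 9 - aL x 6 / 13
  | 6 => aL x 5 / 11 - aL x 7 / 15
  | 7 => aL x 6 / 13 - aL x 8 / 17
  | 8 => aL x 7 / 15 - aL x 9 / 19
  | 9 => aL x 8 / 17 - aL x 10 / 21
  | 10 => aL x 9 / 19 - aL x 11 / 23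
  | 11 => aL x 10 / 21 - aL x 12 / 25
  | 12 => aL x 11 / 23 - aL x 13 / 27
  | 13 => aL x 12 / 25 - aL x 14 / 29
  | 14 => aL x 13 / 27 - aL x 15 / 31
  | 15 => aL x 14 / 29 - aL x 16 / 33
  | 16 => aL x 15 / 31 - aL x 17 / 35
  | 17 => aL x 16 / 33 - aL x 18 / 37
  | 18 => aL x 17 / 35 - aL x 19 / 39
  | 19 => aL x 18 / 37 - aL x 20 / 41
  | 20 => aL x 19 / 39 - aL x 21 / 43
  | _ => 0

/-- ladder forms `e_n`, `n ≤ 20` (coefficients of `Θ`) -/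
def eL (x : Fin 42 → ℝ) : ℕ → ℝ
  | 0 => xd x 0 - xd x 1 / 3
  | 1 => xd x 0 / 1 - xd x 2 / 5
  | 2 => xd x 1 / 3 - xd x 3 / 7
  | 3 => xd x 2 / 5 - xd x 4 / 9
  | 4 => xd x 3 / 7 - xd x 5 / 11
  | 5 => xd x 4 / 9 - xd x 6 / 13
  | 6 => xd x 5 / 11 - xd x 7 / 15
  | 7 => xd x 6 / 13 - xd x 8 / 17
  | 8 => xd x 7 / 15 - xd x 9 / 19
  | 9 => xd x 8 / 17 - xd x 10 / 21
  | 10 => xd x 9 / 19 - xd x 11 / 23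
  | 11 => xd x 10 / 21 - xd x 12 / 25
  | 12 => xd x 11 / 23 - xd x 13 / 27
  | 13 => xd x 12 / 25 - xd x 14 / 29
  | 14 => xd x 13 / 27 - xd x 15 / 31
  | 15 => xd x 14 / 29 - xd x 16 / 33
  | 16 => xd x 15 / 31 - xd x 17 / 35
  | 17 => xd x 16 / 33 - xd x 18 / 37
  | 18 => xd x 17 / 35 - xd x 19 / 39
  | 19 => xd x 18 / 37 - xd x 20 / 41
  | 20 => xd x 19 / 39 - xd x 21 / 43
  | _ => 0

/-- the kept vector of two coefficient sequences: `c_2..c_22` then `d_1..d_21` -/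
def stack (c d : ℕ → ℝ) : Fin 42 → ℝ := fun i => if (i : ℕ) < 21 then c ((i : ℕ) + 2) else d ((i : ℕ) - 21 + 1)

/-- dictionary: with `c 0 = c 1 = 0` the re-inserted `c`-sequence of `stack c d` is `c` -/
theorem xc_stack (c d : ℕ → ℝ) (hc0 : c 0 = 0) (hc1 : c 1 = 0) : ∀ n < 23, xc (stack c d) n = c n := by
  intro n hn
  interval_cases n
  · simp only [xc, hc0]
  · simp only [xc, hc1]
  · simp only [xc]; norm_num [stack]
  · simp only [xc]; norm_num [stack]
  · simp only [xc]; norm_num [stack]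
  · simp only [xc]; norm_num [stack]
  · simp only [xc]; norm_num [stack]
  · simp only [xc]; norm_num [stack]
  · simp only [xc]; norm_num [stack]
  · simp only [xc]; norm_num [stack]
  · simp only [xc]; norm_num [stack]
  · simp only [xc]; norm_num [stack]
  · simp only [xc]; norm_num [stack]
  · simp only [xc]; norm_num [stack]
  · simp only [xc]; norm_num [stack]
  · simp only [xc]; norm_num [stack]
  · simp only [xc]; norm_num [stack]
  · simp only [xc]; norm_num [stack]
  · simp only [xc]; norm_num [stack]
  · simp only [xc]; norm_num [stack]
  · simp only [xc]; norm_num [stack]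
  · simp only [xc]; norm_num [stack]
  · simp only [xc]; norm_num [stack]

/-- dictionary: with `d 0 = 0` the re-inserted `d`-sequence of `stack c d` is `d` -/
theorem xd_stack (c d : ℕ → ℝ) (hd0 : d 0 = 0) : ∀ n < 22, xd (stack c d) n = d n := by
  intro n hn
  interval_cases n
  · simp only [xd, hd0]
  · simp only [xd]; norm_num [stack]
  · simp only [xd]; norm_num [stack]
  · simp only [xd]; norm_num [stack]
  · simp only [xd]; norm_num [stack]
  · simp only [xd]; norm_num [stack]
  · simp only [xd]; norm_num [stack]
  · simp only [xd]; norm_num [stack]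
  · simp only [xd]; norm_num [stack]
  · simp only [xd]; norm_num [stack]
  · simp only [xd]; norm_num [stack]
  · simp only [xd]; norm_num [stack]
  · simp only [xd]; norm_num [stack]
  · simp only [xd]; norm_num [stack]
  · simp only [xd]; norm_num [stack]
  · simp only [xd]; norm_num [stack]
  · simp only [xd]; norm_num [stack]
  · simp only [xd]; norm_num [stack]
  · simp only [xd]; norm_num [stack]
  · simp only [xd]; norm_num [stack]
  · simp only [xd]; norm_num [stack]
  · simp only [xd]; norm_num [stack]

/-- dictionary: `aL (stack c d)` returns `a` on a ladder pair `(c, a)` with the wall value and `c 0 = c 1 = 0` -/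
theorem aL_stack {c a : ℕ → ℝ} {d : ℕ → ℝ} (hA : IsLadder c a) (ha0 : a 0 = c 0 - c 1 / 3) (hc0 : c 0 = 0) (hc1 : c 1 = 0) :
    ∀ n < 22, aL (stack c d) n = a n := by
  intro n hn
  interval_cases n
  · rw [show aL (stack c d) 0 = xc (stack c d) 0 - xc (stack c d) 1 / 3 from rfl, xc_stack c d hc0 hc1 0 (by norm_num), xc_stack c d hc0 hc1 1 (by norm_num)]; linarith only [ha0]
  · rw [show aL (stack c d) 1 = xc (stack c d) 0 / 1 - xc (stack c d) 2 / 5 from rfl, xc_stack c d hc0 hc1 0 (by norm_num), xc_stack c d hc0 hc1 2 (by norm_num)]; have h := hA 0; norm_num at h ⊢; linarith only [h]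
  · rw [show aL (stack c d) 2 = xc (stack c d) 1 / 3 - xc (stack c d) 3 / 7 from rfl, xc_stack c d hc0 hc1 1 (by norm_num), xc_stack c d hc0 hc1 3 (by norm_num)]; have h := hA 1; norm_num at h ⊢; linarith only [h]
  · rw [show aL (stack c d) 3 = xc (stack c d) 2 / 5 - xc (stack c d) 4 / 9 from rfl, xc_stack c d hc0 hc1 2 (by norm_num), xc_stack c d hc0 hc1 4 (by norm_num)]; have h := hA 2; norm_num at h ⊢; linarith only [h]
  · rw [show aL (stack c d) 4 = xc (stack c d) 3 / 7 - xc (stack c d) 5 / 11 from rfl, xc_stack c d hc0 hc1 3 (by norm_num), xc_stack c d hc0 hc1 5 (by norm_num)]; have h := hA 3; norm_num at h ⊢; linarith only [h]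
  · rw [show aL (stack c d) 5 = xc (stack c d) 4 / 9 - xc (stack c d) 6 / 13 from rfl, xc_stack c d hc0 hc1 4 (by norm_num), xc_stack c d hc0 hc1 6 (by norm_num)]; have h := hA 4; norm_num at h ⊢; linarith only [h]
  · rw [show aL (stack c d) 6 = xc (stack c d) 5 / 11 - xc (stack c d) 7 / 15 from rfl, xc_stack c d hc0 hc1 5 (by norm_num), xc_stack c d hc0 hc1 7 (by norm_num)]; have h := hA 5; norm_num at h ⊢; linarith only [h]
  · rw [show aL (stack c d) 7 = xc (stack c d) 6 / 13 - xc (stack c d) 8 / 17 from rfl, xc_stack c d hc0 hc1 6 (by norm_num), xc_stack c d hc0 hc1 8 (by norm_num)]; have h := hA 6; norm_num at h ⊢; linarith only [h]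
  · rw [show aL (stack c d) 8 = xc (stack c d) 7 / 15 - xc (stack c d) 9 / 19 from rfl, xc_stack c d hc0 hc1 7 (by norm_num), xc_stack c d hc0 hc1 9 (by norm_num)]; have h := hA 7; norm_num at h ⊢; linarith only [h]
  · rw [show aL (stack c d) 9 = xc (stack c d) 8 / 17 - xc (stack c d) 10 / 21 from rfl, xc_stack c d hc0 hc1 8 (by norm_num), xc_stack c d hc0 hc1 10 (by norm_num)]; have h := hA 8; norm_num at h ⊢; linarith only [h]
  · rw [show aL (stack c d) 10 = xc (stack c d) 9 / 19 - xc (stack c d) 11 / 23 from rfl, xc_stack c d hc0 hc1 9 (by norm_num), xc_stack c d hc0 hc1 11 (by norm_num)]; have h := hA 9; norm_num at h ⊢; linarith only [h]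
  · rw [show aL (stack c d) 11 = xc (stack c d) 10 / 21 - xc (stack c d) 12 / 25 from rfl, xc_stack c d hc0 hc1 10 (by norm_num), xc_stack c d hc0 hc1 12 (by norm_num)]; have h := hA 10; norm_num at h ⊢; linarith only [h]
  · rw [show aL (stack c d) 12 = xc (stack c d) 11 / 23 - xc (stack c d) 13 / 27 from rfl, xc_stack c d hc0 hc1 11 (by norm_num), xc_stack c d hc0 hc1 13 (by norm_num)]; have h := hA 11; norm_num at h ⊢; linarith only [h]
  · rw [show aL (stack c d) 13 = xc (stack c d) 12 / 25 - xc (stack c d) 14 / 29 from rfl, xc_stack c d hc0 hc1 12 (by norm_num), xc_stack c d hc0 hc1 14 (by norm_num)]; have h := hA 12; norm_num at h ⊢; linarith only [h]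
  · rw [show aL (stack c d) 14 = xc (stack c d) 13 / 27 - xc (stack c d) 15 / 31 from rfl, xc_stack c d hc0 hc1 13 (by norm_num), xc_stack c d hc0 hc1 15 (by norm_num)]; have h := hA 13; norm_num at h ⊢; linarith only [h]
  · rw [show aL (stack c d) 15 = xc (stack c d) 14 / 29 - xc (stack c d) 16 / 33 from rfl, xc_stack c d hc0 hc1 14 (by norm_num), xc_stack c d hc0 hc1 16 (by norm_num)]; have h := hA 14; norm_num at h ⊢; linarith only [h]
  · rw [show aL (stack c d) 16 = xc (stack c d) 15 / 31 - xc (stack c d) 17 / 35 from rfl, xc_stack c d hc0 hc1 15 (by norm_num), xc_stack c d hc0 hc1 17 (by norm_num)]; have h := hA 15; norm_num at h ⊢; linarith only [h]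
  · rw [show aL (stack c d) 17 = xc (stack c d) 16 / 33 - xc (stack c d) 18 / 37 from rfl, xc_stack c d hc0 hc1 16 (by norm_num), xc_stack c d hc0 hc1 18 (by norm_num)]; have h := hA 16; norm_num at h ⊢; linarith only [h]
  · rw [show aL (stack c d) 18 = xc (stack c d) 17 / 35 - xc (stack c d) 19 / 39 from rfl, xc_stack c d hc0 hc1 17 (by norm_num), xc_stack c d hc0 hc1 19 (by norm_num)]; have h := hA 17; norm_num at h ⊢; linarith only [h]
  · rw [show aL (stack c d) 19 = xc (stack c d) 18 / 37 - xc (stack c d) 20 / 41 from rfl, xc_stack c d hc0 hc1 18 (by norm_num), xc_stack c d hc0 hc1 20 (by norm_num)]; have h := hA 18; norm_num at h ⊢; linarith only [h]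
  · rw [show aL (stack c d) 20 = xc (stack c d) 19 / 39 - xc (stack c d) 21 / 43 from rfl, xc_stack c d hc0 hc1 19 (by norm_num), xc_stack c d hc0 hc1 21 (by norm_num)]; have h := hA 19; norm_num at h ⊢; linarith only [h]
  · rw [show aL (stack c d) 21 = xc (stack c d) 20 / 41 - xc (stack c d) 22 / 45 from rfl, xc_stack c d hc0 hc1 20 (by norm_num), xc_stack c d hc0 hc1 22 (by norm_num)]; have h := hA 20; norm_num at h ⊢; linarith only [h]

/-- dictionary: `bL (stack c d)` returns `b` (two ladders) -/
theorem bL_stack {c a b : ℕ → ℝ} {d : ℕ → ℝ} (hA : IsLadder c a) (hB : IsLadder a b) (ha0 : a 0 = c 0 - c 1 / 3) (hb0 : b 0 = a 0 - a 1 / 3)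
    (hc0 : c 0 = 0) (hc1 : c 1 = 0) : ∀ n < 21, bL (stack c d) n = b n := by
  intro n hn
  interval_cases n
  · rw [show bL (stack c d) 0 = aL (stack c d) 0 - aL (stack c d) 1 / 3 from rfl, aL_stack hA ha0 hc0 hc1 0 (by norm_num), aL_stack hA ha0 hc0 hc1 1 (by norm_num)]; linarith only [hb0]
  · rw [show bL (stack c d) 1 = aL (stack c d) 0 / 1 - aL (stack c d) 2 / 5 from rfl, aL_stack hA ha0 hc0 hc1 0 (by norm_num), aL_stack hA ha0 hc0 hc1 2 (by norm_num)]; have h := hB 0; norm_num at h ⊢; linarith only [h]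
  · rw [show bL (stack c d) 2 = aL (stack c d) 1 / 3 - aL (stack c d) 3 / 7 from rfl, aL_stack hA ha0 hc0 hc1 1 (by norm_num), aL_stack hA ha0 hc0 hc1 3 (by norm_num)]; have h := hB 1; norm_num at h ⊢; linarith only [h]
  · rw [show bL (stack c d) 3 = aL (stack c d) 2 / 5 - aL (stack c d) 4 / 9 from rfl, aL_stack hA ha0 hc0 hc1 2 (by norm_num), aL_stack hA ha0 hc0 hc1 4 (by norm_num)]; have h := hB 2; norm_num at h ⊢; linarith only [h]
  · rw [show bL (stack c d) 4 = aL (stack c d) 3 / 7 - aL (stack c d) 5 / 11 from rfl, aL_stack hA ha0 hc0 hc1 3 (by norm_num), aL_stack hA ha0 hc0 hc1 5 (by norm_num)]; have h := hB 3; norm_num at h ⊢; linarith only [h]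
  · rw [show bL (stack c d) 5 = aL (stack c d) 4 / 9 - aL (stack c d) 6 / 13 from rfl, aL_stack hA ha0 hc0 hc1 4 (by norm_num), aL_stack hA ha0 hc0 hc1 6 (by norm_num)]; have h := hB 4; norm_num at h ⊢; linarith only [h]
  · rw [show bL (stack c d) 6 = aL (stack c d) 5 / 11 - aL (stack c d) 7 / 15 from rfl, aL_stack hA ha0 hc0 hc1 5 (by norm_num), aL_stack hA ha0 hc0 hc1 7 (by norm_num)]; have h := hB 5; norm_num at h ⊢; linarith only [h]
  · rw [show bL (stack c d) 7 = aL (stack c d) 6 / 13 - aL (stack c d) 8 / 17 from rfl, aL_stack hA ha0 hc0 hc1 6 (by norm_num), aL_stack hA ha0 hc0 hc1 8 (by norm_num)]; have h := hB 6; norm_num at h ⊢; linarith only [h]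
  · rw [show bL (stack c d) 8 = aL (stack c d) 7 / 15 - aL (stack c d) 9 / 19 from rfl, aL_stack hA ha0 hc0 hc1 7 (by norm_num), aL_stack hA ha0 hc0 hc1 9 (by norm_num)]; have h := hB 7; norm_num at h ⊢; linarith only [h]
  · rw [show bL (stack c d) 9 = aL (stack c d) 8 / 17 - aL (stack c d) 10 / 21 from rfl, aL_stack hA ha0 hc0 hc1 8 (by norm_num), aL_stack hA ha0 hc0 hc1 10 (by norm_num)]; have h := hB 8; norm_num at h ⊢; linarith only [h]
  · rw [show bL (stack c d) 10 = aL (stack c d) 9 / 19 - aL (stack c d) 11 / 23 from rfl, aL_stack hA ha0 hc0 hc1 9 (by norm_num), aL_stack hA ha0 hc0 hc1 11 (by norm_num)]; have h := hB 9; norm_num at h ⊢; linarith only [h]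
  · rw [show bL (stack c d) 11 = aL (stack c d) 10 / 21 - aL (stack c d) 12 / 25 from rfl, aL_stack hA ha0 hc0 hc1 10 (by norm_num), aL_stack hA ha0 hc0 hc1 12 (by norm_num)]; have h := hB 10; norm_num at h ⊢; linarith only [h]
  · rw [show bL (stack c d) 12 = aL (stack c d) 11 / 23 - aL (stack c d) 13 / 27 from rfl, aL_stack hA ha0 hc0 hc1 11 (by norm_num), aL_stack hA ha0 hc0 hc1 13 (by norm_num)]; have h := hB 11; norm_num at h ⊢; linarith only [h]
  · rw [show bL (stack c d) 13 = aL (stack c d) 12 / 25 - aL (stack c d) 14 / 29 from rfl, aL_stack hA ha0 hc0 hc1 12 (by norm_num), aL_stack hA ha0 hc0 hc1 14 (by norm_num)]; have h := hB 12; norm_num at h ⊢; linarith only [h]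
  · rw [show bL (stack c d) 14 = aL (stack c d) 13 / 27 - aL (stack c d) 15 / 31 from rfl, aL_stack hA ha0 hc0 hc1 13 (by norm_num), aL_stack hA ha0 hc0 hc1 15 (by norm_num)]; have h := hB 13; norm_num at h ⊢; linarith only [h]
  · rw [show bL (stack c d) 15 = aL (stack c d) 14 / 29 - aL (stack c d) 16 / 33 from rfl, aL_stack hA ha0 hc0 hc1 14 (by norm_num), aL_stack hA ha0 hc0 hc1 16 (by norm_num)]; have h := hB 14; norm_num at h ⊢; linarith only [h]
  · rw [show bL (stack c d) 16 = aL (stack c d) 15 / 31 - aL (stack c d) 17 / 35 from rfl, aL_stack hA ha0 hc0 hc1 15 (by norm_num), aL_stack hA ha0 hc0 hc1 17 (by norm_num)]; have h := hB 15; norm_num at h ⊢; linarith only [h]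
  · rw [show bL (stack c d) 17 = aL (stack c d) 16 / 33 - aL (stack c d) 18 / 37 from rfl, aL_stack hA ha0 hc0 hc1 16 (by norm_num), aL_stack hA ha0 hc0 hc1 18 (by norm_num)]; have h := hB 16; norm_num at h ⊢; linarith only [h]
  · rw [show bL (stack c d) 18 = aL (stack c d) 17 / 35 - aL (stack c d) 19 / 39 from rfl, aL_stack hA ha0 hc0 hc1 17 (by norm_num), aL_stack hA ha0 hc0 hc1 19 (by norm_num)]; have h := hB 17; norm_num at h ⊢; linarith only [h]
  · rw [show bL (stack c d) 19 = aL (stack c d) 18 / 37 - aL (stack c d) 20 / 41 from rfl, aL_stack hA ha0 hc0 hc1 18 (by norm_num), aL_stack hA ha0 hc0 hc1 20 (by norm_num)]; have h := hB 18; norm_num at h ⊢; linarith only [h]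
  · rw [show bL (stack c d) 20 = aL (stack c d) 19 / 39 - aL (stack c d) 21 / 43 from rfl, aL_stack hA ha0 hc0 hc1 19 (by norm_num), aL_stack hA ha0 hc0 hc1 21 (by norm_num)]; have h := hB 19; norm_num at h ⊢; linarith only [h]

/-- dictionary: `eL (stack c d)` returns `e` with `d 0 = 0` -/
theorem eL_stack {d e : ℕ → ℝ} (c : ℕ → ℝ) (hE : IsLadder d e) (he0 : e 0 = d 0 - d 1 / 3) (hd0 : d 0 = 0) :
    ∀ n < 21, eL (stack c d) n = e n := by
  intro n hn
  interval_cases n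
  · rw [show eL (stack c d) 0 = xd (stack c d) 0 - xd (stack c d) 1 / 3 from rfl, xd_stack c d hd0 0 (by norm_num), xd_stack c d hd0 1 (by norm_num)]; linarith only [he0]
  · rw [show eL (stack c d) 1 = xd (stack c d) 0 / 1 - xd (stack c d) 2 / 5 from rfl, xd_stack c d hd0 0 (by norm_num), xd_stack c d hd0 2 (by norm_num)]; have h := hE 0; norm_num at h ⊢; linarith only [h]
  · rw [show eL (stack c d) 2 = xd (stack c d) 1 / 3 - xd (stack c d) 3 / 7 from rfl, xd_stack c d hd0 1 (by norm_num), xd_stack c d hd0 3 (by norm_num)]; have h := hE 1; norm_num at h ⊢; linarith only [h]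
  · rw [show eL (stack c d) 3 = xd (stack c d) 2 / 5 - xd (stack c d) 4 / 9 from rfl, xd_stack c d hd0 2 (by norm_num), xd_stack c d hd0 4 (by norm_num)]; have h := hE 2; norm_num at h ⊢; linarith only [h]
  · rw [show eL (stack c d) 4 = xd (stack c d) 3 / 7 - xd (stack c d) 5 / 11 from rfl, xd_stack c d hd0 3 (by norm_num), xd_stack c d hd0 5 (by norm_num)]; have h := hE 3; norm_num at h ⊢; linarith only [h]
  · rw [show eL (stack c d) 5 = xd (stack c d) 4 / 9 - xd (stack c d) 6 / 13 from rfl, xd_stack c d hd0 4 (by norm_num), xd_stack c d hd0 6 (by norm_num)]; have h := hE 4; norm_num at h ⊢; linarith only [h]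
  · rw [show eL (stack c d) 6 = xd (stack c d) 5 / 11 - xd (stack c d) 7 / 15 from rfl, xd_stack c d hd0 5 (by norm_num), xd_stack c d hd0 7 (by norm_num)]; have h := hE 5; norm_num at h ⊢; linarith only [h]
  · rw [show eL (stack c d) 7 = xd (stack c d) 6 / 13 - xd (stack c d) 8 / 17 from rfl, xd_stack c d hd0 6 (by norm_num), xd_stack c d hd0 8 (by norm_num)]; have h := hE 6; norm_num at h ⊢; linarith only [h]
  · rw [show eL (stack c d) 8 = xd (stack c d) 7 / 15 - xd (stack c d) 9 / 19 from rfl, xd_stack c d hd0 7 (by norm_num), xd_stack c d hd0 9 (by norm_num)]; have h := hE 7; norm_num at h ⊢; linarith only [h]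
  · rw [show eL (stack c d) 9 = xd (stack c d) 8 / 17 - xd (stack c d) 10 / 21 from rfl, xd_stack c d hd0 8 (by norm_num), xd_stack c d hd0 10 (by norm_num)]; have h := hE 8; norm_num at h ⊢; linarith only [h]
  · rw [show eL (stack c d) 10 = xd (stack c d) 9 / 19 - xd (stack c d) 11 / 23 from rfl, xd_stack c d hd0 9 (by norm_num), xd_stack c d hd0 11 (by norm_num)]; have h := hE 9; norm_num at h ⊢; linarith only [h]
  · rw [show eL (stack c d) 11 = xd (stack c d) 10 / 21 - xd (stack c d) 12 / 25 from rfl, xd_stack c d hd0 10 (by norm_num), xd_stack c d hd0 12 (by norm_num)]; have h := hE 10; norm_num at h ⊢; linarith only [h]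
  · rw [show eL (stack c d) 12 = xd (stack c d) 11 / 23 - xd (stack c d) 13 / 27 from rfl, xd_stack c d hd0 11 (by norm_num), xd_stack c d hd0 13 (by norm_num)]; have h := hE 11; norm_num at h ⊢; linarith only [h]
  · rw [show eL (stack c d) 13 = xd (stack c d) 12 / 25 - xd (stack c d) 14 / 29 from rfl, xd_stack c d hd0 12 (by norm_num), xd_stack c d hd0 14 (by norm_num)]; have h := hE 12; norm_num at h ⊢; linarith only [h]
  · rw [show eL (stack c d) 14 = xd (stack c d) 13 / 27 - xd (stack c d) 15 / 31 from rfl, xd_stack c d hd0 13 (by norm_num), xd_stack c d hd0 15 (by norm_num)]; have h := hE 13; norm_num at h ⊢; linarith only [h]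
  · rw [show eL (stack c d) 15 = xd (stack c d) 14 / 29 - xd (stack c d) 16 / 33 from rfl, xd_stack c d hd0 14 (by norm_num), xd_stack c d hd0 16 (by norm_num)]; have h := hE 14; norm_num at h ⊢; linarith only [h]
  · rw [show eL (stack c d) 16 = xd (stack c d) 15 / 31 - xd (stack c d) 17 / 35 from rfl, xd_stack c d hd0 15 (by norm_num), xd_stack c d hd0 17 (by norm_num)]; have h := hE 15; norm_num at h ⊢; linarith only [h]
  · rw [show eL (stack c d) 17 = xd (stack c d) 16 / 33 - xd (stack c d) 18 / 37 from rfl, xd_stack c d hd0 16 (by norm_num), xd_stack c d hd0 18 (by norm_num)]; have h := hE 16; norm_num at h ⊢; linarith only [h]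
  · rw [show eL (stack c d) 18 = xd (stack c d) 17 / 35 - xd (stack c d) 19 / 39 from rfl, xd_stack c d hd0 17 (by norm_num), xd_stack c d hd0 19 (by norm_num)]; have h := hE 17; norm_num at h ⊢; linarith only [h]
  · rw [show eL (stack c d) 19 = xd (stack c d) 18 / 37 - xd (stack c d) 20 / 41 from rfl, xd_stack c d hd0 18 (by norm_num), xd_stack c d hd0 20 (by norm_num)]; have h := hE 18; norm_num at h ⊢; linarith only [h]
  · rw [show eL (stack c d) 20 = xd (stack c d) 19 / 39 - xd (stack c d) 21 / 43 from rfl, xd_stack c d hd0 19 (by norm_num), xd_stack c d hd0 21 (by norm_num)]; have h := hE 19; norm_num at h ⊢; linarith only [h]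

end Summit.NavierStokesRegularity.TurbBounds.TailN1bG2n12

end
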